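import Literature.MathematicalPhysics.QuantumFieldTheory.QuasiLocalGaugePerturbationDecouplingVolumes
import Literature.Probability.LatticeModels.CoarseCellHyperDefects
import HarnessLib

/-!
# Quasi-local gauge-invariant perturbations, VII-f: the joint system read through coarse cells

Companion (small definitions) file of `QuasiLocalGaugePerturbationDecoupling*.lean` and
`CoarseCellHyperDefects.lean`: given a labelling `cell : Edge d N → CoarseIdx μ` of the links by
the cells of a coarse torus, the joint `(U, mark)` system of a perturbation `W` becomes a system
of sites with TERRITORIES and ACTIVITY EVENTS in the sense of `CoarseCellHyperDefects`:

* `jcell` — a link is homed in its cell (marks get the junk home `0`); `jterr` — the territory of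
  a link is its cell, the territory of a far polymer is the set of cells of its links; `jact` — links
  are never active, a mark is active when on; `jrar` — rarity levels (`0` for links, `r_X` for the
  mark of `X`); `jgood` — goodness of a cell read on the link field;
* `linksIn`, `marksIn` and `hvol_jterr` — the joint volume of a set `A` of cells is the joint
  volume `(linksIn A, marksIn A)` of `…DecouplingVolumes`; `noCrossing_iff`-type lemmas
  (`markOf_eq_false_of_noCrossing`), saturation (`polymerEdges_subset_linksIn`);
* `liftF` and `integral_jointSpec_eq_integral_comp_uOf` — an observable of resampled LINK SITES is,
  under the joint kernels, an observable of the link field (the junk `Bool` coordinate of a link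
  site is almost surely `false`).

No theorem of substance; bookkeeping for the reduction of the dressed-measure mixing bound to the
two-species coarse-cell engine (`…DressedMixing`).

## References

* H.-O. Georgii, *Gibbs Measures and Phase Transitions* (2011), Def. 1.23, Ch. 8.
* R. L. Dobrushin, S. B. Shlosman (1985), §2.
-/

noncomputable section

open MeasureTheory Finset
open scoped ENNReal
open Literature.Probability.LatticeModels (CoarseIdx cdist glueWith glueWith_apply_mem
  glueWith_apply_not_mem measurable_glueWith Specification IsSpecification hvol mem_hvol NoCrossing
  integral_tilted_map_eq_integral_tilted_comp)
open Literature.MathematicalPhysics.QuantumLattice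

namespace Literature.MathematicalPhysics.QuantumFieldTheory

namespace QuasiLocalGaugePerturbation

variable {d N : ℕ} [NeZero N] {G : Type*} {b : ℕ} {μ : Fin d → ℕ}

/-! ### Homes, territories, activities, rarities, goodness -/

/-- Home cells of the joint sites: a link is homed in its cell, a mark at the junk cell `0`.
[folklore] -/
def jcell (cell : Edge d N → CoarseIdx μ) : JSite b d N → CoarseIdx μ :=
  Sum.elim cell fun _ => 0

/-- Territories of the joint sites: the cell of a link; the cells of the links of a far polymer.
[folklore] -/
def jterr (cell : Edge d N → CoarseIdx μ) : JSite b d N → Finset (CoarseIdx μ) :=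
  Sum.elim (fun e => {cell e}) fun X => (polymerEdges b X.1).image cell

/-- Activity events of the joint sites: links are never active; a mark is active when on.
[folklore] -/
def jact : JSite b d N → Set (G × Bool) :=
  Sum.elim (fun _ => ∅) fun _ => {s | s.2 = true}

/-- Rarity levels of the joint sites: `0` for links, `r_X` for the mark of `X`. [folklore] -/
def jrar [Group G] [MeasurableSpace G] (W : QuasiLocalGaugePerturbation d N G b) : JSite b d N → ℝ :=
  Sum.elim (fun _ => 0) fun X => W.rAct X.1

/-- Goodness of a cell in the joint system: goodness of the link field. [folklore] -/
def jgood (good : CoarseIdx μ → Set (GaugeConfig d N G)) :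
    CoarseIdx μ → Set (JSite b d N → G × Bool) :=
  fun c => uOf ⁻¹' good c

/-- Home of a link site. [folklore] -/
@[simp] theorem jcell_inl (cell : Edge d N → CoarseIdx μ) (e : Edge d N) :
    jcell (b := b) cell (Sum.inl e) = cell e := rfl

/-- Territory of a link site. [folklore] -/
@[simp] theorem jterr_inl (cell : Edge d N → CoarseIdx μ) (e : Edge d N) :
    jterr (b := b) cell (Sum.inl e) = {cell e} := rfl

/-- Territory of a mark site. [folklore] -/
@[simp] theorem jterr_inr (cell : Edge d N → CoarseIdx μ) (X : FarPoly b d N) :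
    jterr cell (Sum.inr X) = (polymerEdges b X.1).image cell := rfl

/-- Activity event of a link site. [folklore] -/
@[simp] theorem jact_inl (e : Edge d N) : jact (G := G) (b := b) (Sum.inl e) = ∅ := rfl

/-- Activity event of a mark site. [folklore] -/
@[simp] theorem jact_inr (X : FarPoly b d N) :
    jact (G := G) (Sum.inr X) = {s : G × Bool | s.2 = true} := rfl

/-- Rarity of a link site. [folklore] -/
@[simp] theorem jrar_inl [Group G] [MeasurableSpace G] (W : QuasiLocalGaugePerturbation d N G b)
    (e : Edge d N) : W.jrar (Sum.inl e) = 0 := rfl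

/-- Rarity of a mark site. [folklore] -/
@[simp] theorem jrar_inr [Group G] [MeasurableSpace G] (W : QuasiLocalGaugePerturbation d N G b)
    (X : FarPoly b d N) : W.jrar (Sum.inr X) = W.rAct X.1 := rfl

/-- A site with empty activity event is a link site. [folklore] -/
theorem jact_eq_empty_iff [Nonempty G] (v : JSite b d N) :
    jact (G := G) v = ∅ ↔ ∃ e, v = Sum.inl e := by
  rcases v with e | X
  · simp
  · simp only [jact_inr, reduceCtorEq, exists_false, iff_false]
    obtain ⟨g⟩ := ‹Nonempty G›
    exact Set.nonempty_iff_ne_empty.1 ⟨(g, true), rfl⟩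

/-- Link sites have singleton territories homed at their cell. [folklore] -/
theorem jterr_eq_singleton_of_jact_eq_empty [Nonempty G] (cell : Edge d N → CoarseIdx μ)
    (v : JSite b d N) (hv : jact (G := G) v = ∅) : jterr (b := b) cell v = {jcell cell v} := by
  obtain ⟨e, rfl⟩ := (jact_eq_empty_iff v).1 hv
  rfl

/-- The activity events are measurable. [folklore] -/
theorem measurableSet_jact [MeasurableSpace G] (v : JSite b d N) :
    MeasurableSet (jact (G := G) v) := by
  rcases v with e | X
  · exact MeasurableSet.empty
  · exact measurableSet_eq_fun measurable_snd measurable_const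

/-! ### Joint volumes of cell sets -/

/-- The links homed in the cells of `A`. [folklore] -/
def linksIn (cell : Edge d N → CoarseIdx μ) (A : Finset (CoarseIdx μ)) : Finset (Edge d N) :=
  Finset.univ.filter fun e => cell e ∈ A

/-- The far polymers whose links are all homed in the cells of `A`. [folklore] -/
def marksIn (cell : Edge d N → CoarseIdx μ) (A : Finset (CoarseIdx μ)) : Finset (FarPoly b d N) :=
  Finset.univ.filter fun X => (polymerEdges b X.1).image cell ⊆ A

/-- Membership in `linksIn`. [folklore] -/
@[simp] theorem mem_linksIn {cell : Edge d N → CoarseIdx μ} {A : Finset (CoarseIdx μ)} {e : Edge d N} :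
    e ∈ linksIn cell A ↔ cell e ∈ A := by simp [linksIn]

/-- Membership in `marksIn`. [folklore] -/
@[simp] theorem mem_marksIn {cell : Edge d N → CoarseIdx μ} {A : Finset (CoarseIdx μ)}
    {X : FarPoly b d N} : X ∈ marksIn cell A ↔ (polymerEdges b X.1).image cell ⊆ A := by
  simp [marksIn]

/-- `linksIn A` is a cell-union. [folklore] -/
theorem linksIn_cellUnion (cell : Edge d N → CoarseIdx μ) (A : Finset (CoarseIdx μ)) :
    ∀ v w : Edge d N, cell v = cell w → v ∈ linksIn cell A → w ∈ linksIn cell A := by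
  intro v w hvw hv
  rw [mem_linksIn] at hv ⊢
  rwa [← hvw]

/-- **The joint volume of a cell set** is the joint volume `(linksIn A, marksIn A)`. [folklore] -/
theorem hvol_jterr (cell : Edge d N → CoarseIdx μ) (A : Finset (CoarseIdx μ)) :
    hvol (jterr (b := b) cell) A =
      (linksIn cell A).map (linksEmb b d N) ∪ (marksIn cell A).map (marksEmb b d N) := by
  ext v
  rcases v with e | X
  · simp [mem_hvol]
  · simp [mem_hvol]

/-- Saturation: a far polymer inside `A` has all its links in `linksIn A`. [folklore] -/
theorem polymerEdges_subset_linksIn {cell : Edge d N → CoarseIdx μ} {A : Finset (CoarseIdx μ)}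
    {X : FarPoly b d N} (hX : X ∈ marksIn cell A) : polymerEdges b X.1 ⊆ linksIn cell A := by
  intro e he
  rw [mem_linksIn]
  exact mem_marksIn.1 hX (Finset.mem_image_of_mem _ he)

/-- **No crossing active hyperedge** means: every far polymer outside `A` with a link homed in `A`
carries an inactive mark. [folklore] -/
theorem markOf_eq_false_of_noCrossing {cell : Edge d N → CoarseIdx μ} {A : Finset (CoarseIdx μ)}
    {ζ : JSite b d N → G × Bool} (h : NoCrossing (jterr cell) jact A ζ) (X : FarPoly b d N)
    (hX : X ∉ marksIn cell A) (htouch : ∃ e ∈ linksIn cell A, e ∈ polymerEdges b X.1) :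
    markOf ζ X = false := by
  obtain ⟨e, he, heX⟩ := htouch
  have h1 : ¬ jterr cell (Sum.inr X) ⊆ A := fun hsub => hX (mem_marksIn.2 hsub)
  have h2 : ∃ c ∈ jterr (b := b) cell (Sum.inr X), c ∈ A :=
    ⟨cell e, Finset.mem_image_of_mem _ heX, mem_linksIn.1 he⟩
  have h3 := h (Sum.inr X) h1 h2
  simp only [jact_inr, Set.mem_setOf_eq] at h3
  simpa [markOf] using h3

/-! ### Observables of resampled link sites are observables of the link field -/

/-- The junk-free lift of a link field to a joint configuration (all marks off, all junk `false`).
[folklore] -/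
def liftF [One G] (U : GaugeConfig d N G) : JSite b d N → G × Bool :=
  Sum.elim (fun e => (U e, false)) fun _ => ((1 : G), false)

/-- `liftF` is measurable. [folklore] -/
@[fun_prop] theorem measurable_liftF [One G] [MeasurableSpace G] :
    Measurable (liftF (b := b) (d := d) (N := N) (G := G)) := by
  refine measurable_pi_lambda _ fun v => ?_
  rcases v with e | X
  · exact (measurable_pi_apply e).prodMk measurable_const
  · exact measurable_const

section Junk

variable [Group G] [MeasurableSpace G] [TopologicalSpace G] [IsTopologicalGroup G] [CompactSpace G]
  [BorelSpace G] {Nρ : ℕ} (ρ : G →* Matrix (Fin Nρ) (Fin Nρ) ℂ) (W : QuasiLocalGaugePerturbation d N G b)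
  (hρ : Continuous ρ) [SecondCountableTopology G]

include hρ in
/-- **An observable of resampled link sites is an observable of the link field**: if `f` reads only
link sites of the resampled volume `Λ`, then under the joint kernel of `Λ` it may be replaced by
`(f ∘ liftF) ∘ uOf` (the junk `Bool` coordinate of a resampled link site is `false` almost surely
for the reference measure `Haar ⊗ δ_false`, hence for its tilts). [folklore] -/
theorem integral_jointSpec_eq_integral_comp_uOf (β : ℝ) (Λ : Finset (JSite b d N))
    (ξ : JSite b d N → G × Bool) {f : (JSite b d N → G × Bool) → ℝ} (hf : Measurable f)
    {T : Set (Edge d N)} (hT : ∀ e ∈ T, Sum.inl e ∈ Λ)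
    (hdep : DependsOn f ((fun e => (Sum.inl e : JSite b d N)) '' T)) :
    ∫ σ, f σ ∂(W.jointSpec ρ β Λ ξ) = ∫ σ, f (liftF (uOf σ)) ∂(W.jointSpec ρ β Λ ξ) := by
  classical
  have hφm := W.measurable_jointEnergy ρ hρ (b := b) β
  set π : Measure (↥Λ → G × Bool) := Measure.pi fun v : ↥Λ => W.jointRef v with hπ
  have hfl : Measurable fun σ : JSite b d N → G × Bool => f (liftF (uOf σ)) :=
    hf.comp (measurable_liftF.comp measurable_uOf)
  simp only [jointSpec]
  rw [integral_tilted_map_eq_integral_tilted_comp π (measurable_glueWith Λ ξ) hφm hf,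
    integral_tilted_map_eq_integral_tilted_comp π (measurable_glueWith Λ ξ) hφm hfl]
  refine integral_congr_ae ?_
  -- almost every glued configuration has junk-free link sites
  have hnull : ∀ v : ↥Λ, ∀ e : Edge d N, v.1 = Sum.inl e → π {u | (u v).2 = true} = 0 := by
    intro v e hve
    have hset : {u : ↥Λ → G × Bool | (u v).2 = true} =
        Set.pi Set.univ (Function.update (fun _ : ↥Λ => (Set.univ : Set (G × Bool))) v
          {s | s.2 = true}) := by
      ext u
      simp only [Set.mem_setOf_eq, Set.mem_univ_pi]
      constructor
      · intro hu w
        by_cases hw : w = v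
        · subst hw; simpa [Function.update_self] using hu
        · simp [Function.update_of_ne hw]
      · intro hu
        have := hu v
        simpa [Function.update_self] using this
    rw [hset, hπ, Measure.pi_pi]
    apply Finset.prod_eq_zero (Finset.mem_univ v)
    rw [Function.update_self, show W.jointRef v.1 = W.jointRef (Sum.inl e) by rw [hve]]
    simp only [jointRef, Sum.elim_inl]
    rw [show ({s : G × Bool | s.2 = true}) = Set.univ ×ˢ {true} by ext s; simp,
      Measure.prod_prod]
    simp
  have hae : ∀ᵐ u ∂π, ∀ v : ↥Λ, ∀ e : Edge d N, v.1 = Sum.inl e → (u v).2 = false := by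
    have : ∀ v : ↥Λ, ∀ᵐ u ∂π, ∀ e : Edge d N, v.1 = Sum.inl e → (u v).2 = false := by
      intro v
      rcases hv : v.1 with e | X
      · have h0 := hnull v e hv
        rw [ae_iff]
        refine measure_mono_null (fun u hu => ?_) h0
        simp only [Set.mem_setOf_eq, not_forall, Bool.not_eq_false] at hu ⊢
        obtain ⟨e', -, he'⟩ := hu
        exact he'
      · exact ae_of_all _ fun u e he => by cases he
    exact (ae_all_iff.2 this)
  have hae' : ∀ᵐ u ∂(π.tilted (W.jointEnergy ρ β ∘ fun u => glueWith Λ u ξ)),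
      ∀ v : ↥Λ, ∀ e : Edge d N, v.1 = Sum.inl e → (u v).2 = false :=
    (tilted_absolutelyContinuous _ _).ae_le hae
  filter_upwards [hae'] with u hu
  refine hdep fun w hw => ?_
  obtain ⟨e, heT, rfl⟩ := hw
  have hmem : (Sum.inl e : JSite b d N) ∈ Λ := hT e heT
  simp only [liftF, uOf, Sum.elim_inl]
  rw [glueWith_apply_mem _ _ _ hmem]
  have := hu ⟨Sum.inl e, hmem⟩ e rfl
  ext
  · rfl
  · exact this

end Junk

end QuasiLocalGaugePerturbation

end Literature.MathematicalPhysics.QuantumFieldTheory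

end
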